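import Summits.BirchSwinnertonDyer.BirchSwinnertonDyer.Theses.TwoAdicConverse
import Summits.BirchSwinnertonDyer.Rank1Residual.X5.TwoAdicTargetsEisenstein
import Summits.BirchSwinnertonDyer.Rank1Residual.X5.TwoAdicTargetsClosedFormConverse
import Summits.BirchSwinnertonDyer.Rank1Residual.X5.TwoAdicTargetsPub
import Literature.NumberTheory.EllipticCurves.BSDSelmerCMPConverseProofs
import HarnessLib

/-!
# Route `TwoAdicConverse` (rung S3), crux `GoodOrdinaryRankZeroTwoConverse`: the bridge with EVERY
# printed input a Literature named fact — the rank-`0` `2`-converse at a good ordinary `2` is the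
# Eisenstein half of the `2`-adic main conjecture modulo PUBLISHED facts only (seat `bsd-2adic-ord`)

HONEST FRAMING (cell `bsd-2adic`, run/shared/lean/pub/bsd-2adic/, HUMAN RULINGS D-0036/D-0059):
THEOREMS ONLY; nothing asserted; no definition; no new named fact. Companion of
`Theorems/TwoAdicConverseGoodOrdinaryInputs.lean` with Greenberg's input supplied by the PUBLISHED
parity-free named fact `Greenberg1999.thm41_charValue_rankZero_anyPrime` (kernel glue
`X5.O1.twoAdicEulerCharRankZero_zero_of_greenberg`). On the class "non-CM, good ordinary at `2`" the
crux is reduced, kernel-checked, to: three PUBLISHED named facts as hypotheses {modularity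
`nonempty_modularParametrizationData`, Kato 17.4 (1) at `2` (`kato_divisibility_allPrimes W 2`, only
`X(E/ℚ_∞)` torsion is used), Greenberg Thm. 4.1 parity-free} + ONE OPEN statement ∀-closed over the
class, the Eisenstein half `X5.O1.MainConjectureEisensteinDivisibilityAtTwo W`. The Kato half and the
`μ`-part at `2` are NOT inputs of the converse.

PARTITION (D-0054): none — RANK axis (S3); companion formula cell X5@2 good-ord (B1·O1; 611 book230
classes), object `X5.O1.MainConjectureEisensteinDivisibilityAtTwo`, owner bsd-2adic.
References: [GreenbergLNM1716] Thm. 4.1, §1 pp. 65–66; [SkinnerUrban2014] Thm. 3.6.11 (p odd);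
[Kato2004Asterisque] Thm. 17.4 (1); [MazurTateTeitelbaum1986Invent] §I.14.
-/

set_option autoImplicit false

noncomputable section

open scoped Classical MatrixGroups ModularForm

open CongruenceSubgroup WeierstrassCurve Literature.NumberTheory.EllipticCurves
  Literature.NumberTheory.EllipticCurves.ModularForms
  Literature.NumberTheory.EllipticCurves.Rank1Residual
  Literature.NumberTheory.EllipticCurves.Rank1Residual.Typed
  Summit.BirchSwinnertonDyer.BirchSwinnertonDyer.Theorems.Rank1ResidualX1Defs
  Summit.BirchSwinnertonDyer.Rank1Residual.X5

namespace Summit.BirchSwinnertonDyer.BirchSwinnertonDyer.Theorems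

open Summit.BirchSwinnertonDyer.BirchSwinnertonDyer.Theses.TwoAdicConverse

/-- `L(E,1) ≠ 0` from a finite `2^∞`-Selmer group at a good ordinary `2`, modulo PUBLISHED facts
{modularity, Kato 17.4 (1)(2)@2 (torsion clause), Greenberg Thm. 4.1 parity-free} and the OPEN
Eisenstein half at `W`. Proof: newform `f`, Néron ratio `ϖ > 0`, cyclotomic datum, dual datum `D`
with `char_Λ X = (f_X)`; Greenberg 4.1 gives `f_X(0) ≠ 0` when `Sel` is finite; the Eisenstein half
`ι f_X = ι h·ϖ·L₂(f,α)` gives `L₂(f,α)(0) ≠ 0`; interpolation `L₂(f,α)(0) = (1 − α⁻¹)²·[0]⁺_f` and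
`L(E,1) = [0]⁺_f·Ω⁺_f`, `Ω⁺_f > 0`. [cite: GreenbergLNM1716, Thm. 4.1 (p. 102) and §1 (pp. 65–66)]
[cite: MazurTateTeitelbaum1986Invent, §I.14 (14.3)] [cite: Kato2004Asterisque, Thm. 17.4 (1) (p. 273)] -/
theorem entireLFunction_one_ne_zero_of_finite_selmer_of_facts_of_eisensteinAtTwo
    (W : WeierstrassCurve ℚ) [W.IsElliptic] [W.IsGloballyMinimal]
    (hmod : nonempty_modularParametrizationData)
    (h17 : ∀ [NeZero (W.conductorNorm ℤ)] (f : CuspForm (Gamma0 (W.conductorNorm ℤ)) 2),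
      kato_divisibility_allPrimes W 2 (f := f))
    (hGr : Greenberg1999.thm41_charValue_rankZero_anyPrime) (hgo : GoodOrd W 2)
    (hE : O1.MainConjectureEisensteinDivisibilityAtTwo W)
    (hSel : Finite (W.selmerGroupPInfty 2)) : W.entireLFunction 1 ≠ 0 := by
  have hord : IsOrdinaryAt W 2 := hgo
  have hEC : O1.TwoAdicEulerCharRankZero W 0 := O1.twoAdicEulerCharRankZero_zero_of_greenberg W hGr
  haveI : NeZero (W.conductorNorm ℤ) := ⟨(W.conductorNorm_pos_holds).ne'⟩
  obtain ⟨Dm⟩ := hmod W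
  have hf : IsNewformOf W Dm.f := Dm.isNewformOf
  obtain ⟨ϖ, hϖpos, hϖ, -⟩ := Dm.exists_rat_mul_realPeriodRat_eq_plusPeriod
  obtain ⟨κ, hκ, γ, hγ, hγ'⟩ := exists_isCyclotomic_isTopGenerator_isCyclotomicVariable_holds 2
  obtain ⟨D⟩ := W.nonempty_selmerDualData_holds κ γ hγ
  haveI : Module.Finite (IwasawaAlgebra 2) D.X := D.module_finite_holds hγ
  have hX : D.IsTorsion := (h17 Dm.f κ γ hκ hγ hγ' hord hf D).1
  obtain ⟨fE, hfE⟩ := (charIdeal_isPrincipal_holds 2 D.X).principal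
  have hchar : D.charIdeal = Ideal.span {fE} := hfE
  obtain ⟨h, hh⟩ := hE κ γ hκ hγ hγ' hord Dm.f hf ϖ hϖ D fE hchar
  haveI := hSel
  obtain ⟨u, hu⟩ := hEC hord κ γ hκ hγ hγ' D hX fE hchar hSel
  rw [add_zero, zpow_natCast] at hu
  have h20 : (2 : ℚ_[2]) ≠ 0 := two_ne_zero
  have hNp0 : (Nat.card (AddCommGroup.primaryComponent
      ((integralModelInt W).map (Int.castRingHom (ZMod 2))).toAffine.Point 2) : ℚ_[2]) ≠ 0 := by
    exact_mod_cast Nat.card_pos.ne'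
  have hS0 : (Nat.card (W.selmerGroupPInfty 2) : ℚ_[2]) ≠ 0 := by exact_mod_cast Nat.card_pos.ne'
  have hfE0 : ((PowerSeries.constantCoeff fE : ℤ_[2]) : ℚ_[2]) ≠ 0 := by
    intro h0
    rw [h0, zero_mul] at hu
    exact (mul_ne_zero (mul_ne_zero (mul_ne_zero (coe_units_ne_zero 2 u)
      (pow_ne_zero _ h20)) (pow_ne_zero 2 hNp0)) hS0) hu.symm
  have hι0 : ((PowerSeries.constantCoeff fE : ℤ_[2]) : ℚ_[2]) =
      ((PowerSeries.constantCoeff h : ℤ_[2]) : ℚ_[2]) *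
        ((ϖ : ℚ_[2]) * ((1 - ((unitRoot W 2 : ℤ_[2]) : ℚ_[2])⁻¹) ^ 2 *
          (ratPlusSymbol Dm.f 0 : ℚ_[2]))) := by
    rw [← constantCoeff_iwasawaToPowerSeries 2 fE, hh, map_mul, map_mul,
      constantCoeff_iwasawaToPowerSeries 2 h, PowerSeries.constantCoeff_C,
      constantCoeff_padicLFunction_unitRoot hord hf]
  have hs0 : ratPlusSymbol Dm.f 0 ≠ 0 := by
    intro hs
    apply hfE0
    rw [hι0, hs, Rat.cast_zero, mul_zero, mul_zero, mul_zero]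
  have hper : 0 < plusPeriod Dm.f := IsNewform0.plusPeriod_pos_holds hf.1 hf.coeffField_eq_bot
  rw [hf.entireLFunction_one_eq]
  have hre : ((ratPlusSymbol Dm.f 0 : ℚ) : ℝ) * plusPeriod Dm.f ≠ 0 :=
    mul_ne_zero (by exact_mod_cast hs0) hper.ne'
  exact_mod_cast hre

/-- **The crux `GoodOrdinaryRankZeroTwoConverse` modulo PUBLISHED facts = the Eisenstein half on the
class.** Hypotheses: modularity, Kato 17.4 (1)(2)@2, Greenberg Thm. 4.1 parity-free (tree named facts,
PUBLISHED) + the OPEN Eisenstein half ∀-closed over non-CM good-ordinary-at-`2` curves.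
[cite: GreenbergLNM1716, Thm. 4.1 (p. 102)] [cite: Kato2004Asterisque, Thm. 17.4 (1) (p. 273)]
[cite: SkinnerUrban2014, Thm. 3.6.11 (shape; p odd)] -/
theorem goodOrdinaryRankZeroTwoConverse_of_facts_of_eisenstein
    (hmod : nonempty_modularParametrizationData)
    (h17 : ∀ (W : WeierstrassCurve ℚ) [W.IsElliptic] [W.IsGloballyMinimal]
      [NeZero (W.conductorNorm ℤ)] (f : CuspForm (Gamma0 (W.conductorNorm ℤ)) 2),
      kato_divisibility_allPrimes W 2 (f := f))
    (hGr : Greenberg1999.thm41_charValue_rankZero_anyPrime)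
    (hE : ∀ (W : WeierstrassCurve ℚ) [W.IsElliptic] [W.IsGloballyMinimal],
      ¬ W.HasCM → GoodOrd W 2 → O1.MainConjectureEisensteinDivisibilityAtTwo W) :
    GoodOrdinaryRankZeroTwoConverse := by
  unfold GoodOrdinaryRankZeroTwoConverse
  intro W _ _ hcm hgo hsel
  exact analyticRank_eq_zero_of_entireLFunction_one_ne_zero W
    (entireLFunction_one_ne_zero_of_finite_selmer_of_facts_of_eisensteinAtTwo W hmod
      (fun f => h17 W f) hGr hgo (hE W hcm hgo)
      ((finite_selmerGroupPInfty_iff_selmerCorank_eq_zero W 2).2 hsel))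

/-- **One-child form modulo PUBLISHED facts: the `2`-adic main conjecture on the class gives the
converse.** [cite: GreenbergLNM1716, Thm. 4.1 (p. 102)] [cite: CastellaGrossiSkinner2025, Introduction (MC) (shape)] -/
theorem goodOrdinaryRankZeroTwoConverse_of_facts_of_mazurMainConjecture
    (hmod : nonempty_modularParametrizationData)
    (h17 : ∀ (W : WeierstrassCurve ℚ) [W.IsElliptic] [W.IsGloballyMinimal]
      [NeZero (W.conductorNorm ℤ)] (f : CuspForm (Gamma0 (W.conductorNorm ℤ)) 2),
      kato_divisibility_allPrimes W 2 (f := f))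
    (hGr : Greenberg1999.thm41_charValue_rankZero_anyPrime)
    (hMC : ∀ (W : WeierstrassCurve ℚ) [W.IsElliptic] [W.IsGloballyMinimal],
      ¬ W.HasCM → GoodOrd W 2 → MazurMainConjecture W 2) :
    GoodOrdinaryRankZeroTwoConverse :=
  goodOrdinaryRankZeroTwoConverse_of_facts_of_eisenstein hmod h17 hGr
    (fun W _ _ hcm hgo =>
      O1.mainConjectureEisensteinDivisibilityAtTwo_of_mazurMainConjecture W (fun _ => hMC W hcm hgo))

end Summit.BirchSwinnertonDyer.BirchSwinnertonDyer.Theorems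

end
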